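import Summits.Ventures.PackingBounds.Energy.UniversalOptimality
import Mathlib.Analysis.SpecialFunctions.Pow.Deriv

/-!
# `E₈`, the Leech lattice and the 600-cell maximise the sum of pairwise distances
(Kolushov–Yudin 1997 / Andreev for `E₈` and Leech; Cohn–Kumar 2007, p. 5: the case `f(r) = 2 - r^{1/2}`)

Framing: lottery ticket; floor = certified bounds/negative ranges. Venture `PackingBounds` (cell
`pub-packcert`, seat `pub-packcert-energy`), energy-minimisation family — a corollary file.

The potential `a(t) = 2 - (2 - 2t)^{1/2}` (`= 2 - |x - y|` at `t = ⟨x,y⟩` for unit vectors) is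
absolutely monotonic on `[-1,1)`: `a ≥ 0` there and `a^{(k+1)}(t) = 2^k (1/2)(3/2)⋯(k-1/2)
(2-2t)^{-1/2-k} ≥ 0` (`absolutelyMonotoneOn_two_sub_dist`). By the kernel-checked universal optimality
(`UniversalOptimality.lean`, Cohn–Kumar Thm. 1.2) the `E₈` roots, the Leech minimal vectors and the
600-cell therefore MAXIMISE `Σ_{x ≠ y} |x - y|` among configurations of their size — for `E₈` and the
Leech lattice a theorem of Kolushov–Yudin (1997), cited by Cohn–Kumar, p. 5. Stated as
`Σ_{x ≠ y} (2 - |x - y|) ≥` value (`two_sub_dist_energy_ge_E8`, `_Leech`, `_SixHundredCell`) and, for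
`E₈`, as the explicit bound `Σ_{x ≠ y ∈ C} |x - y| ≤ 240 (2 + 56√3 + 126√2 + 56)` (`sum_dist_le_E8`).

## References
* H. Cohn, A. Kumar, *Universally optimal distribution of points on spheres*, J. Amer. Math. Soc.
  20 (2007) 99–148, Theorem 1.2 and p. 5. [`CohnKumar2006`]
* A. V. Kolushov, V. A. Yudin, *Extremal dispositions of points on the sphere*, Anal. Math. 23
  (1997) 25–34 (cited as [KY1] in loc. cit.).
-/

noncomputable section

namespace Summit.Ventures.PackingBounds.Energy

open Finset Set
open scoped ContDiff

namespace DistanceSum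

/-- Iterated derivatives of `t ↦ 2 - (2-2t)^{1/2}` of order `k + 1` on `t < 1`:
`(2^k ∏_{i<k} (1/2 + i)) (2 - 2x)^{-1/2-k}`. [folklore] -/
private theorem iteratedDeriv_two_sub_sqrt (k : ℕ) :
    ∀ x : ℝ, x < 1 → iteratedDeriv (k + 1) (fun t : ℝ => 2 - (2 - 2 * t) ^ (1 / 2 : ℝ)) x =
      (2 ^ k * ∏ i ∈ range k, (1 / 2 + (i : ℝ))) * (2 - 2 * x) ^ (-1 / 2 - (k : ℝ)) := by
  induction k with
  | zero =>
    intro x hx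
    have h2x : (2 : ℝ) - 2 * x ≠ 0 := by linarith
    have hlin : HasDerivAt (fun y : ℝ => 2 - 2 * y) (-2) x := by
      simpa using ((hasDerivAt_id x).const_mul (2 : ℝ)).const_sub 2
    have hpow := hlin.rpow_const (p := (1 / 2 : ℝ)) (Or.inl h2x)
    have hder := hpow.const_sub (2 : ℝ)
    rw [zero_add, iteratedDeriv_one, hder.deriv]
    have he : (1 / 2 : ℝ) - 1 = -1 / 2 - ((0 : ℕ) : ℝ) := by push_cast; ring
    rw [he]
    simp
  | succ k ih =>
    intro x hx
    rw [iteratedDeriv_succ]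
    have hev : iteratedDeriv (k + 1) (fun t : ℝ => 2 - (2 - 2 * t) ^ (1 / 2 : ℝ)) =ᶠ[nhds x]
        fun y => (2 ^ k * ∏ i ∈ range k, (1 / 2 + (i : ℝ))) * (2 - 2 * y) ^ (-1 / 2 - (k : ℝ)) := by
      filter_upwards [isOpen_Iio.mem_nhds hx] with y hy using ih y hy
    rw [hev.deriv_eq]
    have h2x : (2 : ℝ) - 2 * x ≠ 0 := by linarith
    have hlin : HasDerivAt (fun y : ℝ => 2 - 2 * y) (-2) x := by
      simpa using ((hasDerivAt_id x).const_mul (2 : ℝ)).const_sub 2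
    have hpow := hlin.rpow_const (p := -1 / 2 - (k : ℝ)) (Or.inl h2x)
    have hder := hpow.const_mul (2 ^ k * ∏ i ∈ range k, (1 / 2 + (i : ℝ)))
    rw [hder.deriv, Finset.prod_range_succ]
    have hsplit : (2 - 2 * x) ^ (-1 / 2 - (k : ℝ) - 1) = (2 - 2 * x) ^ (-1 / 2 - ((k + 1 : ℕ) : ℝ)) := by
      congr 1; push_cast; ring
    rw [hsplit]
    ring

/-- **`2 - |x-y|` is an absolutely monotonic potential**: `t ↦ 2 - (2 - 2t)^{1/2}` is absolutely
monotonic on `[-1, 1)` (Mathlib's `AbsolutelyMonotoneOn`). [folklore] -/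
theorem absolutelyMonotoneOn_two_sub_dist :
    AbsolutelyMonotoneOn (fun t : ℝ => 2 - (2 - 2 * t) ^ (1 / 2 : ℝ)) (Ico (-1) 1) := by
  have hS := uniqueDiffOn_Ico (-1 : ℝ) 1
  have hcd : ∀ x : ℝ, x < 1 → ContDiffAt ℝ ∞ (fun t : ℝ => 2 - (2 - 2 * t) ^ (1 / 2 : ℝ)) x := by
    intro x hx
    have h2x : (2 : ℝ) - 2 * x ≠ 0 := by linarith
    exact contDiffAt_const.sub ((Real.contDiffAt_rpow_const_of_ne (p := (1 / 2 : ℝ)) h2x).comp x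
      (contDiffAt_const.sub (contDiffAt_const.mul contDiffAt_id)))
  rw [AbsolutelyMonotoneOn.iff_iteratedDerivWithin_nonneg hS]
  refine ⟨fun x hx => (hcd x hx.2).contDiffWithinAt, fun n x hx => ?_⟩
  rw [iteratedDerivWithin_eq_iteratedDeriv hS ((hcd x hx.2).of_le (mod_cast le_top)) hx]
  have h2x : (0 : ℝ) < 2 - 2 * x := by linarith [hx.2]
  cases n with
  | zero =>
    -- `a(x) = 2 - (2-2x)^{1/2} ≥ 0` since `2 - 2x ≤ 4`
    rw [iteratedDeriv_zero, sub_nonneg]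
    have h4 : (2 - 2 * x) ^ (1 / 2 : ℝ) ≤ (4 : ℝ) ^ (1 / 2 : ℝ) :=
      Real.rpow_le_rpow h2x.le (by linarith [hx.1]) (by norm_num)
    have h42 : (4 : ℝ) ^ (1 / 2 : ℝ) = 2 := by
      rw [show (4 : ℝ) = 2 ^ (2 : ℝ) by norm_num, ← Real.rpow_mul (by norm_num)]
      norm_num
    linarith
  | succ k =>
    rw [iteratedDeriv_two_sub_sqrt k x hx.2]
    have hprod : 0 ≤ ∏ i ∈ range k, (1 / 2 + (i : ℝ)) := Finset.prod_nonneg fun i _ => by positivity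
    have hpow : 0 ≤ (2 - 2 * x) ^ (-1 / 2 - (k : ℝ)) := Real.rpow_nonneg h2x.le _
    positivity

/-- For unit vectors `(2 - 2⟨x,y⟩)^{1/2} = |x - y|`. [folklore] -/
theorem rpow_half_eq_norm_sub {n : ℕ} {x y : EuclideanSpace ℝ (Fin n)} (hx : ‖x‖ = 1)
    (hy : ‖y‖ = 1) : (2 - 2 * inner ℝ x y) ^ (1 / 2 : ℝ) = ‖x - y‖ := by
  have hsq : ‖x - y‖ ^ 2 = 2 - 2 * inner ℝ x y := by
    rw [@norm_sub_sq_real, hx, hy]; ring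
  rw [← hsq, ← Real.sqrt_eq_rpow, Real.sqrt_sq (norm_nonneg _)]

end DistanceSum

open DistanceSum

open scoped Classical in
/-- **`E₈` maximises the sum of distances** (Kolushov–Yudin form): every 240-point configuration of
unit vectors in `ℝ⁸` has `Σ_{x ≠ y} (2 - |x - y|) ≥ 240 (56 (2 - √3) + 126 (2 - √2) + 56)`, the value
at the E₈ roots (distances `2, √3, √2, 1`). [cite: CohnKumar2006, Theorem 1.2] -/
theorem two_sub_dist_energy_ge_E8 (C : Finset (EuclideanSpace ℝ (Fin 8)))
    (h1 : ∀ x ∈ C, ‖x‖ = 1) (hN : C.card = 240) :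
    (240 : ℝ) * (56 * (2 - Real.sqrt 3) + 126 * (2 - Real.sqrt 2) + 56) ≤
      ∑ x ∈ C, ∑ y ∈ C.erase x, (2 - ‖x - y‖) := by
  have h := UniversalE8.universallyOptimal_of_absolutelyMonotoneOn
    (fun t : ℝ => 2 - (2 - 2 * t) ^ (1 / 2 : ℝ)) absolutelyMonotoneOn_two_sub_dist C h1 hN
  have hR : ∑ x ∈ C, ∑ y ∈ C.erase x, (fun t : ℝ => 2 - (2 - 2 * t) ^ (1 / 2 : ℝ)) (inner ℝ x y) =
      ∑ x ∈ C, ∑ y ∈ C.erase x, (2 - ‖x - y‖) :=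
    Finset.sum_congr rfl fun x hx => Finset.sum_congr rfl fun y hy => by
      simp only [rpow_half_eq_norm_sub (h1 x hx) (h1 y (Finset.mem_of_mem_erase hy))]
  rw [hR] at h
  refine le_trans (le_of_eq ?_) h
  have h4 : (4 : ℝ) ^ (1 / 2 : ℝ) = 2 := by
    rw [show (4 : ℝ) = 2 ^ (2 : ℝ) by norm_num, ← Real.rpow_mul (by norm_num)]; norm_num
  have h3 : (3 : ℝ) ^ (1 / 2 : ℝ) = Real.sqrt 3 := by rw [Real.sqrt_eq_rpow]
  have h2 : (2 : ℝ) ^ (1 / 2 : ℝ) = Real.sqrt 2 := by rw [Real.sqrt_eq_rpow]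
  norm_num [h4, h3, h2]

open scoped Classical in
/-- **`E₈` maximises the sum of pairwise distances, explicit form**: for every 240 unit vectors in
`ℝ⁸`, `Σ_{x ≠ y ∈ C} |x - y| ≤ 240 (2 + 56√3 + 126√2 + 56)` (ordered pairs), with equality for the E₈
roots (Kolushov–Yudin 1997; Cohn–Kumar 2007, p. 5). [cite: CohnKumar2006, Theorem 1.2] -/
theorem sum_dist_le_E8 (C : Finset (EuclideanSpace ℝ (Fin 8)))
    (h1 : ∀ x ∈ C, ‖x‖ = 1) (hN : C.card = 240) :
    ∑ x ∈ C, ∑ y ∈ C.erase x, ‖x - y‖ ≤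
      (240 : ℝ) * (2 + 56 * Real.sqrt 3 + 126 * Real.sqrt 2 + 56) := by
  have h := two_sub_dist_energy_ge_E8 C h1 hN
  have hsplit : ∑ x ∈ C, ∑ y ∈ C.erase x, (2 - ‖x - y‖) =
      ∑ x ∈ C, ∑ y ∈ C.erase x, (2 : ℝ) - ∑ x ∈ C, ∑ y ∈ C.erase x, ‖x - y‖ := by
    rw [← Finset.sum_sub_distrib]
    exact Finset.sum_congr rfl fun x _ => Finset.sum_sub_distrib _ _
  have hconst : ∑ x ∈ C, ∑ y ∈ C.erase x, (2 : ℝ) = 240 * 239 * 2 := by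
    have hin : ∀ x ∈ C, ∑ y ∈ C.erase x, (2 : ℝ) = 239 * 2 := fun x hx => by
      rw [Finset.sum_const, Finset.card_erase_of_mem hx, hN, nsmul_eq_mul]; norm_num
    rw [Finset.sum_congr rfl hin, Finset.sum_const, hN, nsmul_eq_mul]; ring
  rw [hsplit, hconst] at h
  linarith

open scoped Classical in
/-- **The Leech lattice minimal vectors maximise the sum of distances**: every 196560-point
configuration of unit vectors in `ℝ²⁴` has `Σ_{x ≠ y} (2 - |x - y|) ≥ 196560 (4600 (2 - √3) +
47104 (2 - (5/2)^{1/2}) + 93150 (2 - √2) + 47104 (2 - (3/2)^{1/2}) + 4600)`.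
[cite: CohnKumar2006, Theorem 1.2] -/
theorem two_sub_dist_energy_ge_Leech (C : Finset (EuclideanSpace ℝ (Fin 24)))
    (h1 : ∀ x ∈ C, ‖x‖ = 1) (hN : C.card = 196560) :
    (196560 : ℝ) * (4600 * (2 - (3 : ℝ) ^ (1 / 2 : ℝ)) + 47104 * (2 - (5 / 2 : ℝ) ^ (1 / 2 : ℝ))
        + 93150 * (2 - (2 : ℝ) ^ (1 / 2 : ℝ)) + 47104 * (2 - (3 / 2 : ℝ) ^ (1 / 2 : ℝ)) + 4600) ≤
      ∑ x ∈ C, ∑ y ∈ C.erase x, (2 - ‖x - y‖) := by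
  have h := UniversalLeech.universallyOptimal_of_absolutelyMonotoneOn
    (fun t : ℝ => 2 - (2 - 2 * t) ^ (1 / 2 : ℝ)) absolutelyMonotoneOn_two_sub_dist C h1 hN
  have hR : ∑ x ∈ C, ∑ y ∈ C.erase x, (fun t : ℝ => 2 - (2 - 2 * t) ^ (1 / 2 : ℝ)) (inner ℝ x y) =
      ∑ x ∈ C, ∑ y ∈ C.erase x, (2 - ‖x - y‖) :=
    Finset.sum_congr rfl fun x hx => Finset.sum_congr rfl fun y hy => by
      simp only [rpow_half_eq_norm_sub (h1 x hx) (h1 y (Finset.mem_of_mem_erase hy))]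
  rw [hR] at h
  refine le_trans (le_of_eq ?_) h
  have h4 : (4 : ℝ) ^ (1 / 2 : ℝ) = 2 := by
    rw [show (4 : ℝ) = 2 ^ (2 : ℝ) by norm_num, ← Real.rpow_mul (by norm_num)]; norm_num
  norm_num [h4]

open scoped Classical in
/-- **The regular 600-cell maximises the sum of distances** among 120-point configurations on `S³`:
`Σ_{x ≠ y} (2 - |x - y|) ≥` its value at the 600-cell. [cite: CohnKumar2006, Theorem 1.2] -/
theorem two_sub_dist_energy_ge_SixHundredCell (C : Finset (EuclideanSpace ℝ (Fin 4)))
    (h1 : ∀ x ∈ C, ‖x‖ = 1) (hN : C.card = 120) :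
    (120 : ℝ) * ((2 - (2 - 2 * (-1 : ℝ)) ^ (1 / 2 : ℝ))
        + 12 * (2 - (2 - 2 * ((-1 / 4 : ℝ) + (-1 / 4 : ℝ) * Real.sqrt 5)) ^ (1 / 2 : ℝ))
        + 20 * (2 - (2 - 2 * (-1 / 2 : ℝ)) ^ (1 / 2 : ℝ))
        + 12 * (2 - (2 - 2 * ((1 / 4 : ℝ) + (-1 / 4 : ℝ) * Real.sqrt 5)) ^ (1 / 2 : ℝ))
        + 30 * (2 - (2 - 2 * (0 : ℝ)) ^ (1 / 2 : ℝ))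
        + 12 * (2 - (2 - 2 * ((-1 / 4 : ℝ) + (1 / 4 : ℝ) * Real.sqrt 5)) ^ (1 / 2 : ℝ))
        + 20 * (2 - (2 - 2 * (1 / 2 : ℝ)) ^ (1 / 2 : ℝ))
        + 12 * (2 - (2 - 2 * ((1 / 4 : ℝ) + (1 / 4 : ℝ) * Real.sqrt 5)) ^ (1 / 2 : ℝ))) ≤
      ∑ x ∈ C, ∑ y ∈ C.erase x, (2 - ‖x - y‖) := by
  have h := UniversalSixHundredCell.universallyOptimal_of_absolutelyMonotoneOn
    (fun t : ℝ => 2 - (2 - 2 * t) ^ (1 / 2 : ℝ)) absolutelyMonotoneOn_two_sub_dist C h1 hN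
  have hR : ∑ x ∈ C, ∑ y ∈ C.erase x, (fun t : ℝ => 2 - (2 - 2 * t) ^ (1 / 2 : ℝ)) (inner ℝ x y) =
      ∑ x ∈ C, ∑ y ∈ C.erase x, (2 - ‖x - y‖) :=
    Finset.sum_congr rfl fun x hx => Finset.sum_congr rfl fun y hy => by
      simp only [rpow_half_eq_norm_sub (h1 x hx) (h1 y (Finset.mem_of_mem_erase hy))]
  rw [hR] at h
  exact h

end Summit.Ventures.PackingBounds.Energy

end
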